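import Literature.Analysis.FluidPDE.ElgindiSliceBoundary
import HarnessLib

/-!
# Boundary continuity of solutions on the strip: from slice energies to a classical stream function
([Elgindi2021] §7 (PolarBSL) "with the natural boundary conditions"; [ElgindiGhoulMasmoudi2021] §2.2)

Topic `Literature/Analysis/FluidPDE`. Support file (one definition with body, proved theorems, no
named facts) on the proof path of the named fact
`Literature.Analysis.FluidPDE.Elgindi.ElgindiGhoulMasmoudi2021_stabilityCore`
(`ElgindiStabilityDecomposition.lean`). T. M. Elgindi, Ann. of Math. 194 (2021) =
arXiv:1904.04795, §7 (p. 19): the elliptic problem `L(Ψ) = F` "with the natural boundary conditions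
`Ψ(R,0) = Ψ(R,π/2) = 0`"; Elgindi–Ghoul–Masmoudi, arXiv:1910.14071, §2.2 (p. 7).

The solutions of `L_αΨ = F` produced variationally and by closure (`ElgindiLinearSolvability`,
`ElgindiTheoremTwoClosure`) are smooth in the OPEN strip with weighted square-integrable
derivatives; the tree's notion `IsStreamFunction` asks in addition for continuity up to the sides
`θ = 0, π/2` and the Dirichlet values there. This file bridges the two [folklore]:
* `stripExt Ψ` is the extension of `Ψ` by `0` outside the open quarter in `θ`; it agrees with `Ψ` on
  the strip together with all slice derivatives, so `L_α(stripExt Ψ) = L_αΨ` there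
  (`ellipticOp_stripExt`);
* if `∂_θΨ, ∂_R∂_θΨ ∈ L²((a,b) × (0,π/2))` then the slices `Ψ(R,·)`, `R ∈ [a,b]`, are uniformly
  `½`-Hölder: `(Ψ(R,θ') − Ψ(R,θ))² ≤ M|θ' − θ|` (`sq_sub_le`, from the uniform slice bound of
  `ElgindiSliceBounds`), hence have boundary limits, which are continuous in `R`;
* if moreover `Ψ²/sin²(2θ) ∈ L¹((a,b) × (0,π/2))` (the Hardy membership encoding the Dirichlet
  conditions) the limits vanish for a.e. `R` (`ElgindiSliceBoundary`), hence for all `R ∈ (a,b)`,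
  with the uniform decay `Ψ(R,θ)² ≤ Mθ`, `Ψ(R,θ)² ≤ M(π/2 − θ)`;
* consequently `stripExt Ψ` is continuous on `(0,∞) × [0,π/2]` (`continuousOn_stripExt`) and is a
  classical stream function of `L_αΨ` (`isStreamFunction_stripExt`).
-/

noncomputable section

open MeasureTheory Set Real Filter Function
open _root_.Topology
open scoped ENNReal ContDiff

namespace Literature.Analysis.FluidPDE

namespace Elgindi

/-! ### The extension by zero in `θ` -/

/-- **Extension by zero outside the open quarter in `θ`**: `stripExt Ψ (z,θ) = Ψ(z,θ)` for
`0 < θ < π/2` and `0` otherwise. [folklore] -/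
def stripExt (Ψ : ℝ → ℝ → ℝ) (z θ : ℝ) : ℝ := if θ ∈ Ioo 0 (π / 2) then Ψ z θ else 0

/-- On the quarter `stripExt Ψ = Ψ`. [folklore] -/
theorem stripExt_of_mem (Ψ : ℝ → ℝ → ℝ) (z : ℝ) {θ : ℝ} (hθ : θ ∈ Ioo 0 (π / 2)) : stripExt Ψ z θ = Ψ z θ := if_pos hθ

/-- `stripExt Ψ (z, 0) = 0`. [folklore] -/
@[simp] theorem stripExt_zero (Ψ : ℝ → ℝ → ℝ) (z : ℝ) : stripExt Ψ z 0 = 0 := if_neg fun h => lt_irrefl _ h.1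

/-- `stripExt Ψ (z, π/2) = 0`. [folklore] -/
@[simp] theorem stripExt_pi_div_two (Ψ : ℝ → ℝ → ℝ) (z : ℝ) : stripExt Ψ z (π / 2) = 0 := if_neg fun h => lt_irrefl _ h.2

/-- `stripExt Ψ = Ψ` on the strip (uncurried). [folklore] -/
theorem stripExt_eqOn (Ψ : ℝ → ℝ → ℝ) : EqOn (uncurry (stripExt Ψ)) (uncurry Ψ) strip := fun p hp => stripExt_of_mem Ψ p.1 hp.2

/-- Smoothness on the strip is unchanged. [folklore] -/
theorem contDiffOn_stripExt {Ψ : ℝ → ℝ → ℝ} {n : WithTop ℕ∞} (hΨ : ContDiffOn ℝ n (uncurry Ψ) strip) :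
    ContDiffOn ℝ n (uncurry (stripExt Ψ)) strip := hΨ.congr (stripExt_eqOn Ψ)

/-- Radial slices at a quarter angle are unchanged. [folklore] -/
theorem radialSlice_stripExt (Ψ : ℝ → ℝ → ℝ) {θ : ℝ} (hθ : θ ∈ Ioo 0 (π / 2)) : (fun z => stripExt Ψ z θ) = fun z => Ψ z θ :=
  funext fun z => stripExt_of_mem Ψ z hθ

/-- Angular slices agree near every quarter angle. [folklore] -/
theorem thetaSlice_stripExt_eventuallyEq (Ψ : ℝ → ℝ → ℝ) (z : ℝ) {θ : ℝ} (hθ : θ ∈ Ioo 0 (π / 2)) :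
    (fun θ' => stripExt Ψ z θ') =ᶠ[𝓝 θ] fun θ' => Ψ z θ' := by
  filter_upwards [isOpen_Ioo.mem_nhds hθ] with θ' hθ' using stripExt_of_mem Ψ z hθ'

/-- `∂_z(stripExt Ψ) = ∂_zΨ` on the strip. [folklore] -/
theorem dz_stripExt (Ψ : ℝ → ℝ → ℝ) (z : ℝ) {θ : ℝ} (hθ : θ ∈ Ioo 0 (π / 2)) : dz (stripExt Ψ) z θ = dz Ψ z θ := by
  simp only [dz, radialSlice_stripExt Ψ hθ]

/-- `∂_θ(stripExt Ψ) = ∂_θΨ` on the strip. [folklore] -/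
theorem dθ_stripExt (Ψ : ℝ → ℝ → ℝ) (z : ℝ) {θ : ℝ} (hθ : θ ∈ Ioo 0 (π / 2)) : dθ (stripExt Ψ) z θ = dθ Ψ z θ :=
  (thetaSlice_stripExt_eventuallyEq Ψ z hθ).deriv_eq

/-- **`L_α(stripExt Ψ) = L_αΨ` on the strip** (the operator is local). [folklore] -/
theorem ellipticOp_stripExt (α : ℝ) (Ψ : ℝ → ℝ → ℝ) {p : ℝ × ℝ} (hp : p ∈ strip) :
    ellipticOp α (stripExt Ψ) p.1 p.2 = ellipticOp α Ψ p.1 p.2 := by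
  have h1 : dz (dz (stripExt Ψ)) p.1 p.2 = dz (dz Ψ) p.1 p.2 := by
    simp only [dz, radialSlice_stripExt Ψ hp.2]
  have h2 : dz (stripExt Ψ) p.1 p.2 = dz Ψ p.1 p.2 := dz_stripExt Ψ p.1 hp.2
  have h3 : dθ (dθ (stripExt Ψ)) p.1 p.2 = dθ (dθ Ψ) p.1 p.2 := by
    have hev : (fun θ' => dθ (stripExt Ψ) p.1 θ') =ᶠ[𝓝 p.2] fun θ' => dθ Ψ p.1 θ' := by
      filter_upwards [isOpen_Ioo.mem_nhds hp.2] with θ' hθ' using dθ_stripExt Ψ p.1 hθ'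
    exact hev.deriv_eq
  have h4 : dθ (fun z' θ' => Real.tan θ' * stripExt Ψ z' θ') p.1 p.2 = dθ (fun z' θ' => Real.tan θ' * Ψ z' θ') p.1 p.2 := by
    have hev : (fun θ' => Real.tan θ' * stripExt Ψ p.1 θ') =ᶠ[𝓝 p.2] fun θ' => Real.tan θ' * Ψ p.1 θ' := by
      filter_upwards [isOpen_Ioo.mem_nhds hp.2] with θ' hθ'
      rw [stripExt_of_mem Ψ p.1 hθ']
    exact hev.deriv_eq
  unfold ellipticOp
  rw [h1, h2, h3, h4, stripExt_of_mem Ψ p.1 hp.2]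

/-! ### Slices of a function smooth on the strip -/

section slices

variable {Ψ : ℝ → ℝ → ℝ} (hΨ : ContDiffOn ℝ ∞ (uncurry Ψ) strip)
include hΨ

/-- Angular slices inside the strip have the expected derivative. [folklore] -/
theorem hasDerivAt_thetaSlice {R θ : ℝ} (hR : 0 < R) (hθ : θ ∈ Ioo 0 (π / 2)) :
    HasDerivAt (fun θ' => Ψ R θ') (dθ Ψ R θ) θ := by
  have hp : (R, θ) ∈ strip := ⟨hR, hθ⟩
  have hΨ1 : ContDiffOn ℝ 1 (uncurry Ψ) strip := contDiffOn_infty.1 hΨ 1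
  have hd : DifferentiableAt ℝ (uncurry Ψ) (R, θ) := differentiableAt_of_contDiffOn_strip hΨ1 (by norm_num) hp
  have hc : HasDerivAt (fun θ' : ℝ => (R, θ')) ((0 : ℝ), (1 : ℝ)) θ := (hasDerivAt_const θ R).prodMk (hasDerivAt_id θ)
  have h := hd.hasFDerivAt.comp_hasDerivAt θ hc
  have e : (fun θ' => Ψ R θ') = uncurry Ψ ∘ fun θ' => (R, θ') := rfl
  show HasDerivAt (fun θ' => Ψ R θ') (deriv (fun θ' => Ψ R θ') θ) θ
  rw [e, h.deriv]; exact h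

/-- The angular derivative is continuous along angular slices. [folklore] -/
theorem continuousOn_dθ_thetaSlice {R : ℝ} (hR : 0 < R) : ContinuousOn (fun θ => dθ Ψ R θ) (Ioo 0 (π / 2)) := by
  have hΨ2 : ContDiffOn ℝ 2 (uncurry Ψ) strip := contDiffOn_infty.1 hΨ 2
  have hG1 : ContDiffOn ℝ 1 (uncurry (dθ Ψ)) strip := contDiffOn_dθ (n := 1) (by exact_mod_cast hΨ2)
  exact hG1.continuousOn.comp (continuous_const.prodMk continuous_id).continuousOn fun θ hθ => ⟨hR, hθ⟩

/-- `Ψ(R,θ') − Ψ(R,θ) = ∫_θ^{θ'} ∂_θΨ(R,t) dt` inside the quarter. [folklore] -/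
theorem sub_eq_integral_dθ {R θ θ' : ℝ} (hR : 0 < R) (hθ : θ ∈ Ioo 0 (π / 2)) (hθ' : θ' ∈ Ioo 0 (π / 2)) (hle : θ ≤ θ') :
    Ψ R θ' - Ψ R θ = ∫ t in θ..θ', dθ Ψ R t := by
  have hsub : Icc θ θ' ⊆ Ioo 0 (π / 2) := fun t ht => ⟨hθ.1.trans_le ht.1, ht.2.trans_lt hθ'.2⟩
  have h := intervalIntegral.integral_eq_sub_of_hasDerivAt (f := fun t => Ψ R t) (f' := fun t => dθ Ψ R t) (a := θ) (b := θ')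
    (fun t ht => hasDerivAt_thetaSlice hΨ hR (hsub (by rwa [uIcc_of_le hle] at ht)))
    (((continuousOn_dθ_thetaSlice hΨ hR).mono hsub).intervalIntegrable_of_Icc hle)
  exact h.symm

end slices

/-! ### Uniform Hölder continuity of the slices from `∂_θΨ, ∂_R∂_θΨ ∈ L²_loc` -/

/-- **The Hölder modulus** `M = (2/(b−a))∬(∂_θΨ)² + 2(b−a)∬(∂_R∂_θΨ)²` over `(a,b) × (0,π/2)`. [folklore] -/
def holderM (Ψ : ℝ → ℝ → ℝ) (a b : ℝ) : ℝ :=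
  2 / (b - a) * (∫ p in Ioo a b ×ˢ Ioo 0 (π / 2), dθ Ψ p.1 p.2 ^ 2) + 2 * (b - a) * ∫ p in Ioo a b ×ˢ Ioo 0 (π / 2), dz (dθ Ψ) p.1 p.2 ^ 2

section holder

variable {Ψ : ℝ → ℝ → ℝ} (hΨ : ContDiffOn ℝ ∞ (uncurry Ψ) strip) {a b : ℝ} (ha : 0 < a) (hab : a < b)
  (h1 : IntegrableOn (fun p : ℝ × ℝ => dθ Ψ p.1 p.2 ^ 2) (Ioo a b ×ˢ Ioo 0 (π / 2)))
  (h2 : IntegrableOn (fun p : ℝ × ℝ => dz (dθ Ψ) p.1 p.2 ^ 2) (Ioo a b ×ˢ Ioo 0 (π / 2)))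
include hΨ ha hab h1 h2

omit hΨ ha h1 h2 in
/-- `0 ≤ M`. [folklore] -/
theorem holderM_nonneg : 0 ≤ holderM Ψ a b := by
  have h0 : 0 ≤ ∫ p in Ioo a b ×ˢ Ioo 0 (π / 2), dθ Ψ p.1 p.2 ^ 2 := setIntegral_nonneg (measurableSet_Ioo.prod measurableSet_Ioo) fun p _ => sq_nonneg _
  have h0' : 0 ≤ ∫ p in Ioo a b ×ˢ Ioo 0 (π / 2), dz (dθ Ψ) p.1 p.2 ^ 2 := setIntegral_nonneg (measurableSet_Ioo.prod measurableSet_Ioo) fun p _ => sq_nonneg _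
  have hba : 0 < b - a := by linarith
  unfold holderM
  positivity

/-- **Uniform slice energy**: for `R ∈ [a,b]`, `∫_0^{π/2} (∂_θΨ(R,θ))² dθ ≤ M` (and the slice is `L²`). [folklore] -/
theorem slice_energy_le {R : ℝ} (hR : R ∈ Icc a b) :
    IntegrableOn (fun θ => dθ Ψ R θ ^ 2) (Ioo 0 (π / 2)) ∧ ∫ θ in Ioo 0 (π / 2), dθ Ψ R θ ^ 2 ≤ holderM Ψ a b := by
  have hΨ2 : ContDiffOn ℝ 2 (uncurry Ψ) strip := contDiffOn_infty.1 hΨ 2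
  have hG1 : ContDiffOn ℝ 1 (uncurry (dθ Ψ)) strip := contDiffOn_dθ (n := 1) (by exact_mod_cast hΨ2)
  exact integral_slice_sq_le hG1 ha hab h1 h2 hR

/-- **Uniform `½`-Hölder continuity of the slices**: `(Ψ(R,θ') − Ψ(R,θ))² ≤ M|θ' − θ|` for
`R ∈ [a,b]`, `θ, θ' ∈ (0,π/2)`. [folklore] -/
theorem sq_sub_le {R θ θ' : ℝ} (hR : R ∈ Icc a b) (hθ : θ ∈ Ioo 0 (π / 2)) (hθ' : θ' ∈ Ioo 0 (π / 2)) :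
    (Ψ R θ' - Ψ R θ) ^ 2 ≤ holderM Ψ a b * |θ' - θ| := by
  have hRpos : 0 < R := ha.trans_le hR.1
  obtain ⟨hY, hYle⟩ := slice_energy_le hΨ ha hab h1 h2 hR
  -- the ordered case
  have key : ∀ {s t : ℝ}, s ∈ Ioo (0:ℝ) (π / 2) → t ∈ Ioo (0:ℝ) (π / 2) → s ≤ t → (Ψ R t - Ψ R s) ^ 2 ≤ holderM Ψ a b * (t - s) := by
    intro s t hs ht hst
    have hsub : Icc s t ⊆ Ioo 0 (π / 2) := fun u hu => ⟨hs.1.trans_le hu.1, hu.2.trans_lt ht.2⟩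
    rw [sub_eq_integral_dθ hΨ hRpos hs ht hst]
    have hc : ContinuousOn (fun u => dθ Ψ R u) (Icc s t) := (continuousOn_dθ_thetaSlice hΨ hRpos).mono hsub
    have hCS := sq_intervalIntegral_le_on hc hst
    have hmono : ∫ u in s..t, dθ Ψ R u ^ 2 ≤ ∫ u in Ioo 0 (π / 2), dθ Ψ R u ^ 2 := by
      rw [intervalIntegral.integral_of_le hst]
      exact setIntegral_mono_set hY (ae_of_all _ fun u => sq_nonneg _)
        ((show Ioc s t ≤ Ioo 0 (π / 2) from fun u hu => ⟨hs.1.trans hu.1, hu.2.trans_lt ht.2⟩).eventuallyLE)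
    calc (∫ u in s..t, dθ Ψ R u) ^ 2 ≤ (t - s) * ∫ u in s..t, dθ Ψ R u ^ 2 := hCS
      _ ≤ (t - s) * holderM Ψ a b := mul_le_mul_of_nonneg_left (hmono.trans hYle) (by linarith)
      _ = holderM Ψ a b * (t - s) := by ring
  rcases le_total θ θ' with h | h
  · rw [abs_of_nonneg (by linarith)]; exact key hθ hθ' h
  · rw [abs_of_nonpos (by linarith), show (Ψ R θ' - Ψ R θ) ^ 2 = (Ψ R θ - Ψ R θ') ^ 2 by ring, neg_sub]
    exact key hθ' hθ h

/-- **Boundary limits exist**: for `R ∈ [a,b]` the slice `Ψ(R,·)` has limits at `(π/2)⁻` and `0⁺`. [folklore] -/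
theorem exists_sliceLimits {R : ℝ} (hR : R ∈ Icc a b) :
    (∃ L, Tendsto (fun θ => Ψ R θ) (𝓝[<] (π / 2)) (𝓝 L)) ∧ ∃ L, Tendsto (fun θ => Ψ R θ) (𝓝[>] 0) (𝓝 L) := by
  have hRpos : 0 < R := ha.trans_le hR.1
  obtain ⟨hY, -⟩ := slice_energy_le hΨ ha hab h1 h2 hR
  exact exists_tendsto_of_sq_integrable_deriv (by positivity : (0:ℝ) < π / 2)
    (fun θ hθ => hasDerivAt_thetaSlice hΨ hRpos hθ) (continuousOn_dθ_thetaSlice hΨ hRpos) hY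

/-- **Rate of convergence at `0⁺`**: `(Ψ(R,θ) − L₀)² ≤ Mθ`. [folklore] -/
theorem sq_sub_lim_left_le {R : ℝ} (hR : R ∈ Icc a b) {L : ℝ} (hL : Tendsto (fun θ => Ψ R θ) (𝓝[>] 0) (𝓝 L))
    {θ : ℝ} (hθ : θ ∈ Ioo 0 (π / 2)) : (Ψ R θ - L) ^ 2 ≤ holderM Ψ a b * θ := by
  have hlim1 : Tendsto (fun θ' => (Ψ R θ - Ψ R θ') ^ 2) (𝓝[>] 0) (𝓝 ((Ψ R θ - L) ^ 2)) := (tendsto_const_nhds.sub hL).pow 2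
  have hlim2 : Tendsto (fun θ' : ℝ => holderM Ψ a b * |θ - θ'|) (𝓝[>] 0) (𝓝 (holderM Ψ a b * |θ - 0|)) :=
    ((tendsto_const_nhds.sub tendsto_id).abs.const_mul _).mono_left nhdsWithin_le_nhds
  rw [sub_zero, abs_of_pos hθ.1] at hlim2
  refine le_of_tendsto_of_tendsto hlim1 hlim2 ?_
  have hev : ∀ᶠ θ' in 𝓝[>] (0:ℝ), θ' ∈ Ioo 0 (π / 2) := by
    rw [← nhdsWithin_Ioo_eq_nhdsGT (by positivity : (0:ℝ) < π / 2)]; exact self_mem_nhdsWithin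
  filter_upwards [hev] with θ' hθ'
  have := sq_sub_le hΨ ha hab h1 h2 hR hθ' hθ
  rwa [show (Ψ R θ - Ψ R θ') ^ 2 = (Ψ R θ - Ψ R θ') ^ 2 from rfl]

/-- **Rate of convergence at `(π/2)⁻`**: `(Ψ(R,θ) − L₁)² ≤ M(π/2 − θ)`. [folklore] -/
theorem sq_sub_lim_right_le {R : ℝ} (hR : R ∈ Icc a b) {L : ℝ} (hL : Tendsto (fun θ => Ψ R θ) (𝓝[<] (π / 2)) (𝓝 L))
    {θ : ℝ} (hθ : θ ∈ Ioo 0 (π / 2)) : (Ψ R θ - L) ^ 2 ≤ holderM Ψ a b * (π / 2 - θ) := by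
  have hlim1 : Tendsto (fun θ' => (Ψ R θ - Ψ R θ') ^ 2) (𝓝[<] (π / 2)) (𝓝 ((Ψ R θ - L) ^ 2)) := (tendsto_const_nhds.sub hL).pow 2
  have hlim2 : Tendsto (fun θ' : ℝ => holderM Ψ a b * |θ - θ'|) (𝓝[<] (π / 2)) (𝓝 (holderM Ψ a b * |θ - π / 2|)) :=
    ((tendsto_const_nhds.sub tendsto_id).abs.const_mul _).mono_left nhdsWithin_le_nhds
  rw [abs_of_neg (by linarith [hθ.2]), neg_sub] at hlim2
  refine le_of_tendsto_of_tendsto hlim1 hlim2 ?_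
  have hev : ∀ᶠ θ' in 𝓝[<] (π / 2 : ℝ), θ' ∈ Ioo 0 (π / 2) := by
    rw [← nhdsWithin_Ioo_eq_nhdsLT (by positivity : (0:ℝ) < π / 2)]; exact self_mem_nhdsWithin
  filter_upwards [hev] with θ' hθ'
  exact sq_sub_le hΨ ha hab h1 h2 hR hθ' hθ

/-- **The left boundary trace** `L₀(R) = lim_{θ→0⁺} Ψ(R,θ)` (a genuine limit for `R ∈ [a,b]`). [folklore] -/
theorem tendsto_limLeft {R : ℝ} (hR : R ∈ Icc a b) :
    Tendsto (fun θ => Ψ R θ) (𝓝[>] 0) (𝓝 (limUnder (𝓝[>] (0:ℝ)) fun θ => Ψ R θ)) :=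
  tendsto_nhds_limUnder (exists_sliceLimits hΨ ha hab h1 h2 hR).2

/-- **The right boundary trace** `L₁(R) = lim_{θ→(π/2)⁻} Ψ(R,θ)`. [folklore] -/
theorem tendsto_limRight {R : ℝ} (hR : R ∈ Icc a b) :
    Tendsto (fun θ => Ψ R θ) (𝓝[<] (π / 2)) (𝓝 (limUnder (𝓝[<] (π / 2 : ℝ)) fun θ => Ψ R θ)) :=
  tendsto_nhds_limUnder (exists_sliceLimits hΨ ha hab h1 h2 hR).1

/-- **The boundary traces are continuous in `R`** (uniform limits of the continuous slices
`R ↦ Ψ(R,θ)`). [folklore] -/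
theorem continuousOn_limLeft : ContinuousOn (fun R => limUnder (𝓝[>] (0:ℝ)) fun θ => Ψ R θ) (Icc a b) := by
  set M := holderM Ψ a b with hM
  have hM0 : 0 ≤ M := holderM_nonneg hab
  have hΨ1 : ContDiffOn ℝ 1 (uncurry Ψ) strip := contDiffOn_infty.1 hΨ 1
  rw [Metric.continuousOn_iff]
  intro R₀ hR₀ ε hε
  -- an angle `θ₁` with `M θ₁ < (ε/3)²`
  obtain ⟨θ₁, hθ₁, hθ₁M⟩ : ∃ θ₁ ∈ Ioo (0:ℝ) (π / 2), M * θ₁ < (ε / 3) ^ 2 := by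
    refine ⟨min (π / 4) ((ε / 3) ^ 2 / (2 * (M + 1))), ⟨lt_min (by positivity) (by positivity), (min_le_left _ _).trans_lt (by linarith [Real.pi_pos])⟩, ?_⟩
    calc M * min (π / 4) ((ε / 3) ^ 2 / (2 * (M + 1))) ≤ M * ((ε / 3) ^ 2 / (2 * (M + 1))) := mul_le_mul_of_nonneg_left (min_le_right _ _) hM0
      _ < (ε / 3) ^ 2 := by
          rw [← sub_pos]
          have key : (ε / 3) ^ 2 - M * ((ε / 3) ^ 2 / (2 * (M + 1))) = (ε / 3) ^ 2 * (1 - M / (2 * (M + 1))) := by ring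
          rw [key]
          have hlt : M / (2 * (M + 1)) < 1 := by rw [div_lt_one (by positivity)]; linarith
          exact mul_pos (by positivity) (sub_pos.2 hlt)
  have hclose : ∀ R ∈ Icc a b, |Ψ R θ₁ - limUnder (𝓝[>] (0:ℝ)) (fun θ => Ψ R θ)| < ε / 3 := by
    intro R hR
    have h := sq_sub_lim_left_le hΨ ha hab h1 h2 hR (tendsto_limLeft hΨ ha hab h1 h2 hR) hθ₁
    have h' : (Ψ R θ₁ - limUnder (𝓝[>] (0:ℝ)) (fun θ => Ψ R θ)) ^ 2 < (ε / 3) ^ 2 := h.trans_lt hθ₁M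
    exact abs_lt_of_sq_lt_sq' h' (by positivity) |>.2 |> fun h2' => abs_sub_lt_iff.2 ⟨by linarith [(abs_lt_of_sq_lt_sq' h' (by positivity)).1], by linarith [(abs_lt_of_sq_lt_sq' h' (by positivity)).1, h2']⟩
  -- continuity of the slice `R ↦ Ψ(R,θ₁)` at `R₀` within `[a,b]`
  have hcs : ContinuousOn (fun R => Ψ R θ₁) (Icc a b) := continuousOn_radial_slice hΨ1 ha hθ₁
  obtain ⟨δ, hδ, hδc⟩ := (Metric.continuousOn_iff.1 hcs) R₀ hR₀ (ε / 3) (by positivity)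
  refine ⟨δ, hδ, fun R hR hdist => ?_⟩
  have hA := hclose R hR
  have hB := hclose R₀ hR₀
  have hC := hδc R hR hdist
  rw [Real.dist_eq] at hC ⊢
  calc |limUnder (𝓝[>] (0:ℝ)) (fun θ => Ψ R θ) - limUnder (𝓝[>] (0:ℝ)) (fun θ => Ψ R₀ θ)|
      = |(limUnder (𝓝[>] (0:ℝ)) (fun θ => Ψ R θ) - Ψ R θ₁) + (Ψ R θ₁ - Ψ R₀ θ₁) + (Ψ R₀ θ₁ - limUnder (𝓝[>] (0:ℝ)) (fun θ => Ψ R₀ θ))| := by ring_nf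
    _ ≤ |limUnder (𝓝[>] (0:ℝ)) (fun θ => Ψ R θ) - Ψ R θ₁| + |Ψ R θ₁ - Ψ R₀ θ₁| + |Ψ R₀ θ₁ - limUnder (𝓝[>] (0:ℝ)) (fun θ => Ψ R₀ θ)| := abs_add_three _ _ _
    _ < ε / 3 + ε / 3 + ε / 3 := by
        gcongr
        · rwa [abs_sub_comm]
    _ = ε := by ring

/-- **The right boundary trace is continuous in `R`.** [folklore] -/
theorem continuousOn_limRight : ContinuousOn (fun R => limUnder (𝓝[<] (π / 2 : ℝ)) fun θ => Ψ R θ) (Icc a b) := by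
  set M := holderM Ψ a b with hM
  have hM0 : 0 ≤ M := holderM_nonneg hab
  have hΨ1 : ContDiffOn ℝ 1 (uncurry Ψ) strip := contDiffOn_infty.1 hΨ 1
  rw [Metric.continuousOn_iff]
  intro R₀ hR₀ ε hε
  obtain ⟨θ₁, hθ₁, hθ₁M⟩ : ∃ θ₁ ∈ Ioo (0:ℝ) (π / 2), M * (π / 2 - θ₁) < (ε / 3) ^ 2 := by
    set η := min (π / 4) ((ε / 3) ^ 2 / (2 * (M + 1))) with hη
    have hη0 : 0 < η := lt_min (by positivity) (by positivity)
    have hηle : η ≤ π / 4 := min_le_left _ _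
    refine ⟨π / 2 - η, ⟨by linarith [Real.pi_pos], by linarith⟩, ?_⟩
    rw [show π / 2 - (π / 2 - η) = η by ring]
    calc M * η ≤ M * ((ε / 3) ^ 2 / (2 * (M + 1))) := mul_le_mul_of_nonneg_left (min_le_right _ _) hM0
      _ < (ε / 3) ^ 2 := by
          rw [← sub_pos]
          have key : (ε / 3) ^ 2 - M * ((ε / 3) ^ 2 / (2 * (M + 1))) = (ε / 3) ^ 2 * (1 - M / (2 * (M + 1))) := by ring
          rw [key]
          have hlt : M / (2 * (M + 1)) < 1 := by rw [div_lt_one (by positivity)]; linarith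
          exact mul_pos (by positivity) (sub_pos.2 hlt)
  have hclose : ∀ R ∈ Icc a b, |Ψ R θ₁ - limUnder (𝓝[<] (π / 2 : ℝ)) (fun θ => Ψ R θ)| < ε / 3 := by
    intro R hR
    have h := sq_sub_lim_right_le hΨ ha hab h1 h2 hR (tendsto_limRight hΨ ha hab h1 h2 hR) hθ₁
    have h' : (Ψ R θ₁ - limUnder (𝓝[<] (π / 2 : ℝ)) (fun θ => Ψ R θ)) ^ 2 < (ε / 3) ^ 2 := h.trans_lt hθ₁M
    have hh := abs_lt_of_sq_lt_sq' h' (by positivity)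
    exact abs_sub_lt_iff.2 ⟨by linarith [hh.1, hh.2], by linarith [hh.1, hh.2]⟩
  have hcs : ContinuousOn (fun R => Ψ R θ₁) (Icc a b) := continuousOn_radial_slice hΨ1 ha hθ₁
  obtain ⟨δ, hδ, hδc⟩ := (Metric.continuousOn_iff.1 hcs) R₀ hR₀ (ε / 3) (by positivity)
  refine ⟨δ, hδ, fun R hR hdist => ?_⟩
  have hA := hclose R hR
  have hB := hclose R₀ hR₀
  have hC := hδc R hR hdist
  rw [Real.dist_eq] at hC ⊢
  calc |limUnder (𝓝[<] (π / 2 : ℝ)) (fun θ => Ψ R θ) - limUnder (𝓝[<] (π / 2 : ℝ)) (fun θ => Ψ R₀ θ)|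
      = |(limUnder (𝓝[<] (π / 2 : ℝ)) (fun θ => Ψ R θ) - Ψ R θ₁) + (Ψ R θ₁ - Ψ R₀ θ₁) + (Ψ R₀ θ₁ - limUnder (𝓝[<] (π / 2 : ℝ)) (fun θ => Ψ R₀ θ))| := by ring_nf
    _ ≤ |limUnder (𝓝[<] (π / 2 : ℝ)) (fun θ => Ψ R θ) - Ψ R θ₁| + |Ψ R θ₁ - Ψ R₀ θ₁| + |Ψ R₀ θ₁ - limUnder (𝓝[<] (π / 2 : ℝ)) (fun θ => Ψ R₀ θ)| := abs_add_three _ _ _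
    _ < ε / 3 + ε / 3 + ε / 3 := by
        gcongr
        · rwa [abs_sub_comm]
    _ = ε := by ring

/-! ### The Dirichlet values from the Hardy membership -/

variable (h3 : IntegrableOn (fun p : ℝ × ℝ => Ψ p.1 p.2 ^ 2 / Real.sin (2 * p.2) ^ 2) (Ioo a b ×ˢ Ioo 0 (π / 2)))
include h3

omit hΨ ha hab h1 h2 in
/-- Almost every slice is Hardy integrable. [folklore] -/
theorem ae_hardySlice : ∀ᵐ R ∂(volume.restrict (Ioo a b)), IntegrableOn (fun θ => Ψ R θ ^ 2 / Real.sin (2 * θ) ^ 2) (Ioo 0 (π / 2)) := by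
  have hprod : (volume.restrict (Ioo a b ×ˢ Ioo 0 (π / 2)) : Measure (ℝ × ℝ)) =
      (volume.restrict (Ioo a b)).prod (volume.restrict (Ioo 0 (π / 2))) := by
    rw [Measure.volume_eq_prod, Measure.prod_restrict]
  have h : Integrable (fun p : ℝ × ℝ => Ψ p.1 p.2 ^ 2 / Real.sin (2 * p.2) ^ 2) ((volume.restrict (Ioo a b)).prod (volume.restrict (Ioo 0 (π / 2)))) := by
    rw [← hprod]; exact h3
  exact h.prod_right_ae

/-- **The boundary traces vanish** on `(a,b)`: a.e. by the Hardy membership of the slices, and then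
everywhere by continuity. [cite: Elgindi2021, §7 (p. 19 of arXiv:1904.04795): "the natural boundary conditions Ψ(R,0) = Ψ(R,π/2) = 0"] -/
theorem limLeft_eq_zero {R : ℝ} (hR : R ∈ Ioo a b) : limUnder (𝓝[>] (0:ℝ)) (fun θ => Ψ R θ) = 0 := by
  have hae : (fun R => limUnder (𝓝[>] (0:ℝ)) fun θ => Ψ R θ) =ᵐ[volume.restrict (Ioo a b)] fun _ => (0:ℝ) := by
    filter_upwards [ae_hardySlice h3, ae_restrict_mem measurableSet_Ioo] with R hRI hRm
    exact tendsto_zero_of_hardy_integrable_left (tendsto_limLeft hΨ ha hab h1 h2 (Ioo_subset_Icc_self hRm)) hRI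
  have hcont := (continuousOn_limLeft hΨ ha hab h1 h2).mono Ioo_subset_Icc_self
  exact Measure.eqOn_Ioo_of_ae_eq _ hae hcont continuousOn_const hR

/-- The right boundary traces vanish on `(a,b)`. [cite: Elgindi2021, §7 (p. 19 of arXiv:1904.04795)] -/
theorem limRight_eq_zero {R : ℝ} (hR : R ∈ Ioo a b) : limUnder (𝓝[<] (π / 2 : ℝ)) (fun θ => Ψ R θ) = 0 := by
  have hae : (fun R => limUnder (𝓝[<] (π / 2 : ℝ)) fun θ => Ψ R θ) =ᵐ[volume.restrict (Ioo a b)] fun _ => (0:ℝ) := by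
    filter_upwards [ae_hardySlice h3, ae_restrict_mem measurableSet_Ioo] with R hRI hRm
    exact tendsto_zero_of_hardy_integrable_right (tendsto_limRight hΨ ha hab h1 h2 (Ioo_subset_Icc_self hRm)) hRI
  have hcont := (continuousOn_limRight hΨ ha hab h1 h2).mono Ioo_subset_Icc_self
  exact Measure.eqOn_Ioo_of_ae_eq _ hae hcont continuousOn_const hR

/-- **Uniform decay at the sides**: `Ψ(R,θ)² ≤ Mθ` and `Ψ(R,θ)² ≤ M(π/2 − θ)` for `R ∈ (a,b)`. [folklore] -/
theorem sq_le_holderM_mul {R : ℝ} (hR : R ∈ Ioo a b) {θ : ℝ} (hθ : θ ∈ Ioo 0 (π / 2)) :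
    Ψ R θ ^ 2 ≤ holderM Ψ a b * θ ∧ Ψ R θ ^ 2 ≤ holderM Ψ a b * (π / 2 - θ) := by
  have hR' : R ∈ Icc a b := Ioo_subset_Icc_self hR
  have hl := sq_sub_lim_left_le hΨ ha hab h1 h2 hR' (tendsto_limLeft hΨ ha hab h1 h2 hR') hθ
  have hr := sq_sub_lim_right_le hΨ ha hab h1 h2 hR' (tendsto_limRight hΨ ha hab h1 h2 hR') hθ
  rw [limLeft_eq_zero hΨ ha hab h1 h2 h3 hR, sub_zero] at hl
  rw [limRight_eq_zero hΨ ha hab h1 h2 h3 hR, sub_zero] at hr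
  exact ⟨hl, hr⟩

/-- The slices tend to `0` at both sides, for every `R ∈ (a,b)`. [cite: Elgindi2021, §7 (p. 19 of arXiv:1904.04795)] -/
theorem tendsto_slice_zero {R : ℝ} (hR : R ∈ Ioo a b) :
    Tendsto (fun θ => Ψ R θ) (𝓝[>] 0) (𝓝 0) ∧ Tendsto (fun θ => Ψ R θ) (𝓝[<] (π / 2)) (𝓝 0) := by
  have hR' : R ∈ Icc a b := Ioo_subset_Icc_self hR
  have hl := tendsto_limLeft hΨ ha hab h1 h2 hR'
  have hr := tendsto_limRight hΨ ha hab h1 h2 hR'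
  rw [limLeft_eq_zero hΨ ha hab h1 h2 h3 hR] at hl
  rw [limRight_eq_zero hΨ ha hab h1 h2 h3 hR] at hr
  exact ⟨hl, hr⟩

end holder

/-! ### Continuity of the extension up to the sides -/

section ext

variable {Ψ : ℝ → ℝ → ℝ} (hΨ : ContDiffOn ℝ ∞ (uncurry Ψ) strip)
  (h1 : ∀ a b : ℝ, 0 < a → a < b → IntegrableOn (fun p : ℝ × ℝ => dθ Ψ p.1 p.2 ^ 2) (Ioo a b ×ˢ Ioo 0 (π / 2)))
  (h2 : ∀ a b : ℝ, 0 < a → a < b → IntegrableOn (fun p : ℝ × ℝ => dz (dθ Ψ) p.1 p.2 ^ 2) (Ioo a b ×ˢ Ioo 0 (π / 2)))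
  (h3 : ∀ a b : ℝ, 0 < a → a < b → IntegrableOn (fun p : ℝ × ℝ => Ψ p.1 p.2 ^ 2 / Real.sin (2 * p.2) ^ 2) (Ioo a b ×ˢ Ioo 0 (π / 2)))
include hΨ h1 h2 h3

/-- **Local uniform bound near the sides**: around `R₀ > 0` there is `M ≥ 0` with `Ψ(R,θ)² ≤ Mθ` and
`Ψ(R,θ)² ≤ M(π/2 − θ)` for `|R − R₀| < R₀/2`, `θ ∈ (0,π/2)`. [folklore] -/
theorem exists_local_decay {R₀ : ℝ} (hR₀ : 0 < R₀) :
    ∃ M : ℝ, 0 ≤ M ∧ ∀ R, |R - R₀| < R₀ / 2 → ∀ θ ∈ Ioo (0:ℝ) (π / 2), Ψ R θ ^ 2 ≤ M * θ ∧ Ψ R θ ^ 2 ≤ M * (π / 2 - θ) := by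
  have ha : 0 < R₀ / 2 := by positivity
  have hab : R₀ / 2 < 2 * R₀ := by linarith
  refine ⟨holderM Ψ (R₀ / 2) (2 * R₀), holderM_nonneg hab, fun R hR θ hθ => ?_⟩
  have hRI : R ∈ Ioo (R₀ / 2) (2 * R₀) := by
    rw [abs_lt] at hR
    exact ⟨by linarith, by linarith⟩
  exact sq_le_holderM_mul hΨ ha hab (h1 _ _ ha hab) (h2 _ _ ha hab) (h3 _ _ ha hab) hRI hθ

/-- **Continuity of the extension by zero on `(0,∞) × [0,π/2]`.** [folklore] -/
theorem continuousOn_stripExt : ContinuousOn (uncurry (stripExt Ψ)) (Ioi 0 ×ˢ Icc 0 (π / 2)) := by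
  intro p hp
  obtain ⟨hp1, hp2⟩ := hp
  have hR₀ : 0 < p.1 := hp1
  rcases eq_or_lt_of_le hp2.1 with h0 | h0
  · -- the side `θ = 0`
    obtain ⟨M, hM0, hM⟩ := exists_local_decay hΨ h1 h2 h3 hR₀
    rw [Metric.continuousWithinAt_iff]
    intro ε hε
    refine ⟨min (p.1 / 2) (ε ^ 2 / (M + 1)), lt_min (by positivity) (by positivity), fun q hq hdist => ?_⟩
    have hq1 : |q.1 - p.1| < p.1 / 2 := by
      have := (max_lt_iff.1 ((Prod.dist_eq (x := q) (y := p)) ▸ hdist)).1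
      rw [Real.dist_eq] at this; exact this.trans_le (min_le_left _ _)
    have hq2 : |q.2 - p.2| < ε ^ 2 / (M + 1) := by
      have := (max_lt_iff.1 ((Prod.dist_eq (x := q) (y := p)) ▸ hdist)).2
      rw [Real.dist_eq] at this; exact this.trans_le (min_le_right _ _)
    have hp0 : uncurry (stripExt Ψ) p = 0 := by
      show stripExt Ψ p.1 p.2 = 0; rw [← h0]; exact stripExt_zero Ψ p.1
    rw [hp0, dist_zero_right, Real.norm_eq_abs]
    show |stripExt Ψ q.1 q.2| < ε
    by_cases hqI : q.2 ∈ Ioo 0 (π / 2)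
    · rw [stripExt_of_mem Ψ q.1 hqI]
      have hb := (hM q.1 hq1 q.2 hqI).1
      have hθlt : q.2 < ε ^ 2 / (M + 1) := by
        rw [← h0, sub_zero] at hq2; exact (le_abs_self _).trans_lt hq2
      have hsq : Ψ q.1 q.2 ^ 2 < ε ^ 2 := by
        calc Ψ q.1 q.2 ^ 2 ≤ M * q.2 := hb
          _ ≤ (M + 1) * q.2 := by nlinarith [hqI.1]
          _ < (M + 1) * (ε ^ 2 / (M + 1)) := by gcongr
          _ = ε ^ 2 := by field_simp
      exact abs_lt_of_sq_lt_sq hsq hε.le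
    · have : stripExt Ψ q.1 q.2 = 0 := if_neg hqI
      rw [this, abs_zero]; exact hε
  rcases eq_or_lt_of_le hp2.2 with hπ | hπ
  · -- the side `θ = π/2`
    obtain ⟨M, hM0, hM⟩ := exists_local_decay hΨ h1 h2 h3 hR₀
    rw [Metric.continuousWithinAt_iff]
    intro ε hε
    refine ⟨min (p.1 / 2) (ε ^ 2 / (M + 1)), lt_min (by positivity) (by positivity), fun q hq hdist => ?_⟩
    have hq1 : |q.1 - p.1| < p.1 / 2 := by
      have := (max_lt_iff.1 ((Prod.dist_eq (x := q) (y := p)) ▸ hdist)).1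
      rw [Real.dist_eq] at this; exact this.trans_le (min_le_left _ _)
    have hq2 : |q.2 - p.2| < ε ^ 2 / (M + 1) := by
      have := (max_lt_iff.1 ((Prod.dist_eq (x := q) (y := p)) ▸ hdist)).2
      rw [Real.dist_eq] at this; exact this.trans_le (min_le_right _ _)
    have hp0 : uncurry (stripExt Ψ) p = 0 := by
      show stripExt Ψ p.1 p.2 = 0; rw [hπ]; exact stripExt_pi_div_two Ψ p.1
    rw [hp0, dist_zero_right, Real.norm_eq_abs]
    show |stripExt Ψ q.1 q.2| < ε
    by_cases hqI : q.2 ∈ Ioo 0 (π / 2)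
    · rw [stripExt_of_mem Ψ q.1 hqI]
      have hb := (hM q.1 hq1 q.2 hqI).2
      have hθlt : π / 2 - q.2 < ε ^ 2 / (M + 1) := by
        rw [hπ] at hq2; rw [abs_sub_comm] at hq2; exact (le_abs_self _).trans_lt hq2
      have hsq : Ψ q.1 q.2 ^ 2 < ε ^ 2 := by
        calc Ψ q.1 q.2 ^ 2 ≤ M * (π / 2 - q.2) := hb
          _ ≤ (M + 1) * (π / 2 - q.2) := by nlinarith [hqI.2]
          _ < (M + 1) * (ε ^ 2 / (M + 1)) := by gcongr
          _ = ε ^ 2 := by field_simp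
      exact abs_lt_of_sq_lt_sq hsq hε.le
    · have : stripExt Ψ q.1 q.2 = 0 := if_neg hqI
      rw [this, abs_zero]; exact hε
  · -- interior point
    have hps : p ∈ strip := ⟨hR₀, h0, hπ⟩
    have hc : ContinuousAt (uncurry Ψ) p := (hΨ.continuousOn.continuousWithinAt hps).continuousAt (isOpen_strip.mem_nhds hps)
    have hev : uncurry (stripExt Ψ) =ᶠ[𝓝 p] uncurry Ψ := by
      filter_upwards [isOpen_strip.mem_nhds hps] with q hq using stripExt_eqOn Ψ hq
    exact (hc.congr_of_eventuallyEq hev).continuousWithinAt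

/-- **The extension by zero is a classical stream function** of `L_αΨ`: `C²` (indeed smooth) on the
strip, continuous up to the sides, with the Dirichlet values, and solving the equation. [cite: Elgindi2021, §7 (p. 19 of arXiv:1904.04795); ElgindiGhoulMasmoudi2021, §2.2 (p. 7 of arXiv:1910.14071)] -/
theorem isStreamFunction_stripExt (α : ℝ) {W : ℝ → ℝ → ℝ} (heq : ∀ p ∈ strip, ellipticOp α Ψ p.1 p.2 = W p.1 p.2) :
    IsStreamFunction α W (stripExt Ψ) where
  contDiffOn := contDiffOn_stripExt (contDiffOn_infty.1 hΨ 2)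
  continuousOn := continuousOn_stripExt hΨ h1 h2 h3
  elliptic z θ hp := by
    have h := ellipticOp_stripExt α Ψ (p := (z, θ)) hp
    simp only at h
    rw [h]; exact heq (z, θ) hp
  bc_zero z _ := stripExt_zero Ψ z
  bc_pi_div_two z _ := stripExt_pi_div_two Ψ z

end ext

end Elgindi

end Literature.Analysis.FluidPDE
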